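import Summits.QuantumFields.YangMills.Theorems.SmallCircleAnchorAbelianisingDeformationUnconditional

/-!
# ATOMIC skeleton for crux `AnchorGap` (stmt-QuantumFields-11141) — lead's alternative hand-off (evidence, not a registered line)

Lead `prover-line-stmt-QuantumFields-11141-0`, 2026-08-17. The minimal honest cut recommended in
`LEAD-REPORT-birth.md`: ONE physics stub S3 = the crux body for the FIXED abelianising `V`, with the
existential schedule `∃ E ≥ ε₁` replaced by "for all sufficiently strong pinning `s ≥ s₀(β)`"; the glue
is pure logic + choice. S3 is WEAKER than the registered `stub_annealedHolonomyGap` (no uniformity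
over pinnings `υ`) and still implies the crux; it is the cleanest statement of the analytic content
(robust Polyakov mechanism for one good pinning). `lean check`: sorries = 1 = `stub_pinnedGapAllStrengths`;
`AnchorGap_of : AnchorGap` by name.
-/

set_option autoImplicit false

noncomputable section

namespace Summit.QuantumFields.YangMills.Cruxes.AnchorGap.Atomic

open MeasureTheory
open Literature.MathematicalPhysics.QuantumFieldTheory
open Summit.QuantumFields.YangMills.Theses.SmallCircleAnchor
open Summit.QuantumFields.YangMills.Theorems

/-- **Stub S3 — the pinned gap at all large strengths (OPEN; crux-sized).** For every compact simple
`G`, faithful unitary `r`, abelianising deformation `V` minimised exactly on `Cl(g₀)` (`C_G(g₀)`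
abelian) and `T ≥ 1` there is `β₀` such that for every `β ≥ β₀` there is a pinning threshold `s₀`
such that for EVERY `s ≥ s₀` the `s V`-pinned finite-temperature Wilson theory on `ℤ_T × (ℤ/L)³`
clusters exponentially in space uniformly in `L` (verbatim the crux body with `E β ↦ s`). -/
theorem stub_pinnedGapAllStrengths :
    ∀ (G : Type) [Group G] [TopologicalSpace G] [IsTopologicalGroup G] [CompactSpace G], IsCompactSimpleLieGroup G → letI : MeasurableSpace G := borel G; haveI : BorelSpace G := ⟨rfl⟩; ∀ (r : LatticeRep G) (V : G → ℝ) (g₀ : G), Continuous V → (∀ a g : G, V (a * g * a⁻¹) = V g) → (∀ g : G, V g₀ ≤ V g) → (∀ g : G, V g = V g₀ → ∃ a : G, g = a * g₀ * a⁻¹) → (∀ a b : G, a * g₀ = g₀ * a → b * g₀ = g₀ * b → a * b = b * a) → ∀ (T : ℕ) [NeZero T], ∃ β₀ : ℝ, ∀ β : ℝ, β₀ ≤ β → ∃ s₀ : ℝ, ∀ s : ℝ, s₀ ≤ s → ∃ m : ℝ, 0 < m ∧ ∀ w : ℕ, ∃ C : ℝ, ∀ (L : ℕ) [NeZero L], let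 St := ZMod T × (Fin 3 → ZMod L); let Cfg := St × Option (Fin 3) → G; let ν : MeasureTheory.Measure Cfg := MeasureTheory.Measure.pi fun _ => haarProbability G; let sh : St → Option (Fin 3) → St := fun x μ => Option.elim μ (x.1 + 1, x.2) fun i => (x.1, x.2 + Pi.single i 1); let pl : Cfg → St → Option (Fin 3) → Option (Fin 3) → G := fun U x μ κ => U (x, μ) * U (sh x μ, κ) * (U (sh x κ, μ))⁻¹ * (U (x, κ))⁻¹; let act : Cfg → ℝ := fun U => β * ∑ x : St, ∑ i : Fin 3, (r.ρ (pl U x none (some i))).trace.re + β * ∑ x : St, ∑ q : {q : Fin 3 × Fin 3 // q.1 < q.2}, (r.ρ (pl U x (some q.1.1) (some q.1.2))).trace.re; let P : Cfg → (Fin 3 → ZMod L) → G := fun U x => (List.ofFn fun t : Fin T => U ((((t : ℕ) : ZMod T), x), none)).prod; let wgt : Cfg → ℝ := fun U => Real.exp (act U - s * ∑ x : Fin 3 → ZMod L, V (P U x)); let Ex : (Cfg → ℝ) → ℝ := fun F => (∫ U, F U * wgt U ∂ν) / (∫ U, wgt U ∂ν); let σ : ℕ → Cfg → Cfg := fun n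 U p => U ((p.1.1, p.1.2 + Pi.single 0 (n : ZMod L)), p.2); ∀ (c : Fin 3 → ZMod L), let Loc := fun F : Cfg → ℝ => Measurable F ∧ (∀ U, |F U| ≤ 1) ∧ ∀ U U', (∀ p, (∀ i : Fin 3, (p.1.2 i - c i).val ≤ w) → U p = U' p) → F U = F U'; ∀ F₁ F₂ : Cfg → ℝ, Loc F₁ → Loc F₂ → ∀ n : ℕ, 2 * n < L → |Ex (fun U => F₁ U * F₂ (σ n U)) - Ex F₁ * Ex (fun U => F₂ (σ n U))| ≤ C * Real.exp (-(m * n)) := by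
  sorry

/-- **Composition**: `V`, `g₀` from `exists_abelianisingDeformation_holds`; schedule
`E β := max ε₁ (s₀ β)` with `s₀` chosen by `stub_pinnedGapAllStrengths` (and `0` below `β₀`). -/
theorem AnchorGap_of : AnchorGap := by
  intro G _ _ _ _ hG r
  letI : MeasurableSpace G := borel G
  haveI : BorelSpace G := ⟨rfl⟩
  obtain ⟨V, hVc, hVcl, g₀, hmin, huniq, hab⟩ := exists_abelianisingDeformation_holds hG r
  refine ⟨V, ⟨hVc, hVcl, g₀, hmin, huniq, hab⟩, ?_⟩
  intro T _ ε₁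
  classical
  obtain ⟨β₀, hβ⟩ := stub_pinnedGapAllStrengths G hG r V g₀ hVc hVcl hmin huniq hab T
  have sched : ∀ β : ℝ, ∃ s₀ : ℝ, ∀ (hb : β₀ ≤ β) (s : ℝ), s₀ ≤ s → ∃ m : ℝ, 0 < m ∧ ∀ w : ℕ, ∃ C : ℝ, ∀ (L : ℕ) [NeZero L], let St := ZMod T × (Fin 3 → ZMod L); let Cfg := St × Option (Fin 3) → G; let ν : MeasureTheory.Measure Cfg := MeasureTheory.Measure.pi fun _ => haarProbability G; let sh : St → Option (Fin 3) → St := fun x μ => Option.elim μ (x.1 + 1, x.2) fun i => (x.1, x.2 + Pi.single i 1); let pl : Cfg → St → Option (Fin 3) → Option (Fin 3) → G := fun U x μ κ => U (x, μ) * U (sh x μ, κ) * (U (sh x κ, μ))⁻¹ * (U (x, κ))⁻¹; let act : Cfg → ℝ := fun U => β * ∑ x : St, ∑ i : Fin 3, (r.ρ (pl U x none (some i))).trace.re + β * ∑ x : St, ∑ q : {q : Fin 3 × Fin 3 // q.1 < q.2}, (r.ρ (pl U x (some q.1.1) (some q.1.2))).trace.re; let P : Cfg → (Fin 3 → ZMod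 L) → G := fun U x => (List.ofFn fun t : Fin T => U ((((t : ℕ) : ZMod T), x), none)).prod; let wgt : Cfg → ℝ := fun U => Real.exp (act U - s * ∑ x : Fin 3 → ZMod L, V (P U x)); let Ex : (Cfg → ℝ) → ℝ := fun F => (∫ U, F U * wgt U ∂ν) / (∫ U, wgt U ∂ν); let σ : ℕ → Cfg → Cfg := fun n U p => U ((p.1.1, p.1.2 + Pi.single 0 (n : ZMod L)), p.2); ∀ (c : Fin 3 → ZMod L), let Loc := fun F : Cfg → ℝ => Measurable F ∧ (∀ U, |F U| ≤ 1) ∧ ∀ U U', (∀ p, (∀ i : Fin 3, (p.1.2 i - c i).val ≤ w) → U p = U' p) → F U = F U'; ∀ F₁ F₂ : Cfg → ℝ, Loc F₁ → Loc F₂ → ∀ n : ℕ, 2 * n < L → |Ex (fun U => F₁ U * F₂ (σ n U)) - Ex F₁ * Ex (fun U => F₂ (σ n U))| ≤ C * Real.exp (-(m * n)) := by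
    intro β
    by_cases hb : β₀ ≤ β
    · obtain ⟨s₀, hs₀⟩ := hβ β hb
      exact ⟨s₀, fun _ s hs => hs₀ s hs⟩
    · exact ⟨0, fun h => absurd h hb⟩
  choose s₀ hs₀ using sched
  refine ⟨fun β => max ε₁ (s₀ β), fun β => le_max_left _ _, β₀, fun β hb => ?_⟩
  exact hs₀ β hb (max ε₁ (s₀ β)) (le_max_right _ _)

/-- Signature match. -/
example : Summit.QuantumFields.YangMills.Theses.SmallCircleAnchor.AnchorGap := AnchorGap_of

end Summit.QuantumFields.YangMills.Cruxes.AnchorGap.Atomic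

end
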